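import Literature.Analysis.SpecialFunctions.HypergeometricEulerIntegralSeries
import Mathlib.MeasureTheory.Integral.DominatedConvergence
import HarnessLib

/-!
# Gauss's summation theorem for Euler's hypergeometric integral: the value and the limit at `z = 1`

Continuation of `HypergeometricEulerIntegral.lean` (`eulerHypergeometric a b c z =
Γ(c)/(Γ(b)Γ(c−b)) ∫₀¹ t^{b−1}(1−t)^{c−b−1}(1−zt)^{−a} dt`, holomorphic on `H = {Re z < 1}` for
`Re c > Re b > 0`). At `z = 1` the last factor merges with the second one,
`t^{b−1}(1−t)^{c−a−b−1}`, a Beta integrand, which converges iff moreover `Re(c − a − b) > 0`;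
then **Gauss's summation theorem** (DLMF 15.4.20)

  `E(a,b;c;1) = Γ(c)Γ(c−a−b) / (Γ(c−a)Γ(c−b))`

holds for the literal value of `eulerHypergeometric a b c 1` (`eulerHypergeometric_one`), and
`E(a,b;c;z) → E(a,b;c;1)` as `z → 1` inside the half-plane `H` (no tangential restriction is
needed: `Re(1 − zt) ≥ 1 − t` for `Re z ≤ 1` gives the dominating function
`3^{|Re a|} e^{π|Im a|} · t^{Re b−1}(1−t)^{Re(c−b)−1−max(Re a,0)}`), by dominated convergence:
`continuousWithinAt_eulerHypergeometric_one`, `tendsto_eulerHypergeometric_one`; along the reals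
from the left `tendsto_eulerHypergeometric_ofReal_one`, and for Mathlib's series on `(−1,1)`
(where it equals `E`, DLMF 15.6.1) the Abel-type statement `tendsto_ordinaryHypergeometric_one`:
`₂F₁(a,b;c;x) → Γ(c)Γ(c−a−b)/(Γ(c−a)Γ(c−b))` as `x → 1⁻`.

Not here: the convergence of the SERIES `Σ (a)ₙ(b)ₙ/((c)ₙ n!)` at `z = 1` itself (it needs the
asymptotics of the coefficients), and the two-term connection formula DLMF 15.8.4 for
`Re(c − a − b) ≤ 0`.

References: NIST DLMF (15.4.20), (15.6.1) [DLMF]; Andrews–Askey–Roy, *Special Functions* (1999),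
Thm 2.2.2 [AndrewsAskeyRoy1999].
-/

noncomputable section

open Filter Metric MeasureTheory Set
open scoped Topology

namespace Literature.Analysis.SpecialFunctions.Hypergeometric

/-! ### The integrand and the integral at `z = 1` -/

/-- At `z = 1` and `t ≠ 1` Euler's integrand is the Beta integrand
`t^{b−1}(1−t)^{(c−a−b)−1}`. [cite: DLMF, 15.4.20] -/
theorem eulerIntegrand_one_eq (a b c : ℂ) {t : ℝ} (ht : t ≠ 1) :
    eulerIntegrand a b c 1 t = (t : ℂ) ^ (b - 1) * (1 - (t : ℂ)) ^ (c - a - b - 1) := by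
  have h1 : (1 : ℂ) - (t : ℂ) ≠ 0 := sub_ne_zero.2 fun h => ht (by exact_mod_cast h.symm)
  rw [eulerIntegrand, one_mul, show c - a - b - 1 = (c - b - 1) + -a by ring,
    Complex.cpow_add _ _ h1, mul_assoc]

/-- Lebesgue-almost every real number is `≠ 1` (inlined). [folklore] -/
private theorem ae_ne_one : ∀ᵐ t : ℝ, t ≠ 1 := by
  have h : (volume : Measure ℝ) {1} = 0 := measure_singleton 1
  exact (measure_eq_zero_iff_ae_notMem.1 h).mono fun t ht => fun h1 => ht (by simp [h1])

/-- **Convergence at `z = 1`**: for `Re b > 0` and `Re(c − a − b) > 0` Euler's integrand at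
`z = 1` is interval-integrable on `[0,1]` (a Beta integrand off `t = 1`). [cite: DLMF, 15.4.20] -/
theorem intervalIntegrable_eulerIntegrand_one (a : ℂ) {b c : ℂ} (hb : 0 < b.re)
    (h : 0 < (c - a - b).re) : IntervalIntegrable (eulerIntegrand a b c 1) volume 0 1 := by
  refine (Complex.betaIntegral_convergent (u := b) (v := c - a - b) hb h).congr_uIoo ?_
  intro t ht
  rw [uIoo_of_le zero_le_one] at ht
  exact (eulerIntegrand_one_eq a b c ht.2.ne).symm

/-- **Euler's integral at `z = 1` is a Beta integral**: for `Re b > 0`, `Re(c − a − b) > 0`,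
`∫₀¹ t^{b−1}(1−t)^{c−b−1}(1−t)^{−a} dt = B(b, c−a−b) = Γ(b)Γ(c−a−b)/Γ(c−a)`.
[cite: DLMF, 15.4.20] -/
theorem eulerIntegral_one (a : ℂ) {b c : ℂ} (hb : 0 < b.re) (h : 0 < (c - a - b).re) :
    eulerIntegral a b c 1 =
      Complex.Gamma b * Complex.Gamma (c - a - b) / Complex.Gamma (c - a) := by
  have hI : eulerIntegral a b c 1 = Complex.betaIntegral b (c - a - b) := by
    rw [eulerIntegral, Complex.betaIntegral]
    refine intervalIntegral.integral_congr_ae (ae_ne_one.mono fun t ht _ => ?_)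
    exact eulerIntegrand_one_eq a b c ht
  have hca : 0 < (c - a).re := by
    have : (c - a).re = (c - a - b).re + b.re := by simp
    rw [this]; positivity
  have hB := Complex.Gamma_mul_Gamma_eq_betaIntegral hb h
  rw [show b + (c - a - b) = c - a by ring] at hB
  rw [hI, eq_div_iff (Complex.Gamma_ne_zero_of_re_pos hca), hB]
  ring

/-- **Gauss's summation theorem** (DLMF 15.4.20) for Euler's hypergeometric function: for
`Re c > Re b > 0` and `Re(c − a − b) > 0`,
`E(a,b;c;1) = Γ(c)Γ(c−a−b) / (Γ(c−a)Γ(c−b))` — the literal value of `eulerHypergeometric` at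
`z = 1`, where Euler's integral still converges. [cite: DLMF, 15.4.20] -/
theorem eulerHypergeometric_one (a : ℂ) {b c : ℂ} (hb : 0 < b.re) (hbc : b.re < c.re)
    (h : 0 < (c - a - b).re) :
    eulerHypergeometric a b c 1 = Complex.Gamma c * Complex.Gamma (c - a - b) /
      (Complex.Gamma (c - a) * Complex.Gamma (c - b)) := by
  have hΓb : Complex.Gamma b ≠ 0 := Complex.Gamma_ne_zero_of_re_pos hb
  have hΓcb : Complex.Gamma (c - b) ≠ 0 :=
    Complex.Gamma_ne_zero_of_re_pos (by rw [Complex.sub_re]; linarith)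
  have hca : 0 < (c - a).re := by
    have : (c - a).re = (c - a - b).re + b.re := by simp
    rw [this]; positivity
  have hΓca : Complex.Gamma (c - a) ≠ 0 := Complex.Gamma_ne_zero_of_re_pos hca
  rw [eulerHypergeometric, eulerIntegral_one a hb h]
  field_simp

/-! ### A dominating function near `z = 1` -/

/-- **Domination of the `z`-dependent factor** uniformly in `Re z ≤ 1`, `‖z‖ ≤ 2`: for
`t ∈ [0,1)`, `‖(1 − zt)^{−a}‖ ≤ 3^{|Re a|} e^{π|Im a|} (1 − t)^{−max(Re a, 0)}` — from
`‖w^{−a}‖ = ‖w‖^{−Re a} e^{Im a · arg w}`, `1 − t ≤ Re(1 − zt) ≤ ‖1 − zt‖ ≤ 3`. [folklore] -/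
theorem norm_one_sub_mul_cpow_neg_le (a : ℂ) {z : ℂ} (hz : z.re ≤ 1) (hz2 : ‖z‖ ≤ 2) {t : ℝ}
    (ht0 : 0 ≤ t) (ht1 : t < 1) :
    ‖(1 - z * (t : ℂ)) ^ (-a)‖ ≤
      (3 : ℝ) ^ |a.re| * Real.exp (Real.pi * |a.im|) * (1 - t) ^ (-max a.re 0) := by
  set w : ℂ := 1 - z * (t : ℂ) with hw
  have hre : 1 - t ≤ w.re := by
    have e : w.re = 1 - z.re * t := by simp [hw, Complex.mul_re]
    rw [e]
    linarith [mul_le_of_le_one_left ht0 hz]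
  have h1t : 0 < 1 - t := by linarith
  have hw_lower : 1 - t ≤ ‖w‖ := hre.trans (Complex.re_le_norm w)
  have hw_pos : 0 < ‖w‖ := h1t.trans_le hw_lower
  have hw0 : w ≠ 0 := norm_pos_iff.1 hw_pos
  have hw_upper : ‖w‖ ≤ 3 := by
    calc ‖w‖ ≤ ‖(1 : ℂ)‖ + ‖z * (t : ℂ)‖ := norm_sub_le _ _
      _ = 1 + ‖z‖ * t := by
          rw [norm_one, norm_mul, Complex.norm_real, Real.norm_eq_abs, abs_of_nonneg ht0]
      _ ≤ 1 + 2 * 1 := by gcongr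
      _ = 3 := by norm_num
  -- the modulus of the principal power
  have hnorm : ‖w ^ (-a)‖ = ‖w‖ ^ (-a.re) * Real.exp (Complex.arg w * a.im) := by
    rw [Complex.norm_cpow_of_ne_zero hw0, Complex.neg_re, Complex.neg_im, mul_neg, Real.exp_neg,
      div_inv_eq_mul]
  -- the argument factor
  have harg : Real.exp (Complex.arg w * a.im) ≤ Real.exp (Real.pi * |a.im|) := by
    refine Real.exp_le_exp.2 ?_
    calc Complex.arg w * a.im ≤ |Complex.arg w * a.im| := le_abs_self _
      _ = |Complex.arg w| * |a.im| := abs_mul _ _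
      _ ≤ Real.pi * |a.im| := by gcongr; exact Complex.abs_arg_le_pi w
  -- the modulus factor
  have hmod : ‖w‖ ^ (-a.re) ≤ (3 : ℝ) ^ |a.re| * (1 - t) ^ (-max a.re 0) := by
    rcases le_or_gt 0 a.re with ha | ha
    · rw [max_eq_left ha, abs_of_nonneg ha]
      have h1 : ‖w‖ ^ (-a.re) ≤ (1 - t) ^ (-a.re) :=
        Real.rpow_le_rpow_of_nonpos h1t hw_lower (by linarith)
      have h2 : (1 : ℝ) ≤ (3 : ℝ) ^ a.re := Real.one_le_rpow (by norm_num) ha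
      have h3 : 0 ≤ (1 - t) ^ (-a.re) := Real.rpow_nonneg h1t.le _
      calc ‖w‖ ^ (-a.re) ≤ 1 * (1 - t) ^ (-a.re) := by rw [one_mul]; exact h1
        _ ≤ (3 : ℝ) ^ a.re * (1 - t) ^ (-a.re) := by gcongr
    · rw [max_eq_right ha.le, abs_of_neg ha, neg_zero, Real.rpow_zero, mul_one]
      exact Real.rpow_le_rpow (norm_nonneg _) hw_upper (by linarith)
  have h3pos : 0 ≤ (3 : ℝ) ^ |a.re| * (1 - t) ^ (-max a.re 0) :=
    mul_nonneg (Real.rpow_nonneg (by norm_num) _) (Real.rpow_nonneg h1t.le _)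
  rw [hnorm]
  calc ‖w‖ ^ (-a.re) * Real.exp (Complex.arg w * a.im)
      ≤ ((3 : ℝ) ^ |a.re| * (1 - t) ^ (-max a.re 0)) * Real.exp (Real.pi * |a.im|) := by
        gcongr
    _ = (3 : ℝ) ^ |a.re| * Real.exp (Real.pi * |a.im|) * (1 - t) ^ (-max a.re 0) := by ring

/-- The norm of the Beta-type factors for `t ∈ (0,1)`:
`‖t^{b−1}(1−t)^{s}‖ = t^{Re b − 1}(1−t)^{Re s}`. [folklore] -/
theorem norm_cpow_mul_one_sub_cpow {t : ℝ} (ht0 : 0 < t) (ht1 : t < 1) (p q : ℂ) :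
    ‖(t : ℂ) ^ p * (1 - (t : ℂ)) ^ q‖ = t ^ p.re * (1 - t) ^ q.re := by
  rw [norm_mul, Complex.norm_cpow_eq_rpow_re_of_pos ht0,
    show (1 : ℂ) - (t : ℂ) = ((1 - t : ℝ) : ℂ) by push_cast; ring,
    Complex.norm_cpow_eq_rpow_re_of_pos (by linarith)]

/-- The real Beta integrand `t^{u−1}(1−t)^{v−1}` is interval-integrable on `[0,1]` for
`u, v > 0` (from Mathlib's complex `Complex.betaIntegral_convergent`; inlined — the tree has it
under unrelated imports). [folklore] -/
private theorem intervalIntegrable_realBetaIntegrand {u v : ℝ} (hu : 0 < u) (hv : 0 < v) :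
    IntervalIntegrable (fun t : ℝ => t ^ (u - 1) * (1 - t) ^ (v - 1)) volume 0 1 := by
  have h := (Complex.betaIntegral_convergent (u := (u : ℂ)) (v := (v : ℂ))
    (by simpa using hu) (by simpa using hv)).norm
  refine h.congr_uIoo fun t ht => ?_
  rw [uIoo_of_le zero_le_one] at ht
  simp only
  rw [norm_cpow_mul_one_sub_cpow ht.1 ht.2]
  simp

/-! ### The limit `z → 1` inside the half-plane -/

/-- **Continuity of Euler's integral at `z = 1` from inside `{Re z < 1}`** (dominated
convergence): for `Re c > Re b > 0` and `Re(c − a − b) > 0`,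
`∫₀¹ t^{b−1}(1−t)^{c−b−1}(1−zt)^{−a} dt → ∫₀¹ t^{b−1}(1−t)^{c−a−b−1} dt` as `z → 1`, `Re z < 1`
(non-tangentially or not). [cite: DLMF, 15.4.20] -/
theorem continuousWithinAt_eulerIntegral_one (a : ℂ) {b c : ℂ} (hb : 0 < b.re)
    (hbc : b.re < c.re) (h : 0 < (c - a - b).re) :
    ContinuousWithinAt (eulerIntegral a b c) {z : ℂ | z.re < 1} 1 := by
  set S : Set ℂ := {z : ℂ | z.re < 1} with hS
  -- the dominating function
  set C : ℝ := (3 : ℝ) ^ |a.re| * Real.exp (Real.pi * |a.im|) with hC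
  set v : ℝ := (c - b).re - max a.re 0 with hv
  have hv0 : 0 < v := by
    rw [hv]
    rcases le_or_gt 0 a.re with ha | ha
    · rw [max_eq_left ha]
      have : (c - a - b).re = (c - b).re - a.re := by simp; ring
      linarith
    · rw [max_eq_right ha.le, sub_zero, Complex.sub_re]
      linarith
  set bound : ℝ → ℝ := fun t => C * (t ^ (b.re - 1) * (1 - t) ^ (v - 1)) with hbound
  have hSmem : ∀ᶠ z in 𝓝[S] (1 : ℂ), z ∈ S ∩ ball (1 : ℂ) 1 :=
    inter_mem_nhdsWithin S (ball_mem_nhds (1 : ℂ) one_pos)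
  have hF_meas : ∀ᶠ z in 𝓝[S] (1 : ℂ),
      AEStronglyMeasurable (eulerIntegrand a b c z) (volume.restrict (uIoc (0 : ℝ) 1)) :=
    hSmem.mono fun z hz =>
      (intervalIntegrable_eulerIntegrand a hb hbc hz.1).def'.aestronglyMeasurable
  have h_bound : ∀ᶠ z in 𝓝[S] (1 : ℂ), ∀ᵐ t ∂volume, t ∈ uIoc (0 : ℝ) 1 →
      ‖eulerIntegrand a b c z t‖ ≤ bound t := by
    refine hSmem.mono fun z hz => ae_ne_one.mono fun t ht1 ht => ?_
    rw [uIoc_of_le zero_le_one] at ht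
    have ht1' : t < 1 := lt_of_le_of_ne ht.2 ht1
    have hz2 : ‖z‖ ≤ 2 := by
      have h1 : ‖z - 1‖ < 1 := mem_ball_iff_norm.1 hz.2
      calc ‖z‖ = ‖(z - 1) + 1‖ := by rw [sub_add_cancel]
        _ ≤ ‖z - 1‖ + ‖(1 : ℂ)‖ := norm_add_le _ _
        _ ≤ 2 := by rw [norm_one]; linarith
    have hfac := norm_one_sub_mul_cpow_neg_le a (le_of_lt hz.1) hz2 ht.1.le ht1'
    have hβ : ‖(t : ℂ) ^ (b - 1) * (1 - (t : ℂ)) ^ (c - b - 1)‖ =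
        t ^ (b.re - 1) * (1 - t) ^ ((c - b).re - 1) := by
      rw [norm_cpow_mul_one_sub_cpow ht.1 ht1']; simp
    have h1t : 0 < 1 - t := by linarith
    calc ‖eulerIntegrand a b c z t‖
        = ‖(t : ℂ) ^ (b - 1) * (1 - (t : ℂ)) ^ (c - b - 1)‖ * ‖(1 - z * (t : ℂ)) ^ (-a)‖ := by
          rw [eulerIntegrand, norm_mul]
      _ ≤ (t ^ (b.re - 1) * (1 - t) ^ ((c - b).re - 1)) * (C * (1 - t) ^ (-max a.re 0)) := by
          rw [hβ]
          exact mul_le_mul_of_nonneg_left hfac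
            (mul_nonneg (Real.rpow_nonneg ht.1.le _) (Real.rpow_nonneg h1t.le _))
      _ = bound t := by
          simp only [hbound, hv]
          rw [show (c - b).re - max a.re 0 - 1 = ((c - b).re - 1) + (-max a.re 0) by ring,
            Real.rpow_add h1t]
          ring
  have bound_integrable : IntervalIntegrable bound volume 0 1 :=
    (intervalIntegrable_realBetaIntegrand hb hv0).const_mul C
  have h_cont : ∀ᵐ t ∂volume, t ∈ uIoc (0 : ℝ) 1 →
      ContinuousWithinAt (fun z => eulerIntegrand a b c z t) S 1 := by
    refine ae_ne_one.mono fun t ht1 ht => ?_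
    rw [uIoc_of_le zero_le_one] at ht
    have ht1' : t < 1 := lt_of_le_of_ne ht.2 ht1
    have hslit : (fun z : ℂ => 1 - z * (t : ℂ)) 1 ∈ Complex.slitPlane := by
      rw [show (fun z : ℂ => 1 - z * (t : ℂ)) 1 = ((1 - t : ℝ) : ℂ) by push_cast; ring]
      exact Complex.ofReal_mem_slitPlane.2 (by linarith)
    have hc : ContinuousAt (fun z : ℂ => (1 - z * (t : ℂ)) ^ (-a)) 1 :=
      ContinuousAt.cpow (by fun_prop) continuousAt_const hslit
    exact (hc.const_mul ((t : ℂ) ^ (b - 1) * (1 - (t : ℂ)) ^ (c - b - 1))).continuousWithinAt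
  exact intervalIntegral.continuousWithinAt_of_dominated_interval hF_meas h_bound
    bound_integrable h_cont

/-- **Continuity of `E(a,b;c;·)` at `z = 1` from inside `{Re z < 1}`** for `Re c > Re b > 0`,
`Re(c − a − b) > 0`. [cite: DLMF, 15.4.20] -/
theorem continuousWithinAt_eulerHypergeometric_one (a : ℂ) {b c : ℂ} (hb : 0 < b.re)
    (hbc : b.re < c.re) (h : 0 < (c - a - b).re) :
    ContinuousWithinAt (eulerHypergeometric a b c) {z : ℂ | z.re < 1} 1 :=
  ContinuousWithinAt.mul continuousWithinAt_const
    (continuousWithinAt_eulerIntegral_one a hb hbc h)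

/-- **Gauss's summation theorem, limit form** (DLMF 15.4.20): for `Re c > Re b > 0` and
`Re(c − a − b) > 0`, `E(a,b;c;z) → Γ(c)Γ(c−a−b)/(Γ(c−a)Γ(c−b))` as `z → 1` inside the
half-plane `Re z < 1`. [cite: DLMF, 15.4.20] -/
theorem tendsto_eulerHypergeometric_one (a : ℂ) {b c : ℂ} (hb : 0 < b.re) (hbc : b.re < c.re)
    (h : 0 < (c - a - b).re) :
    Tendsto (eulerHypergeometric a b c) (𝓝[{z : ℂ | z.re < 1}] 1)
      (𝓝 (Complex.Gamma c * Complex.Gamma (c - a - b) /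
        (Complex.Gamma (c - a) * Complex.Gamma (c - b)))) := by
  rw [← eulerHypergeometric_one a hb hbc h]
  exact continuousWithinAt_eulerHypergeometric_one a hb hbc h

/-- **Gauss's summation theorem along the reals**: for `Re c > Re b > 0`, `Re(c − a − b) > 0`,
`E(a,b;c;x) → Γ(c)Γ(c−a−b)/(Γ(c−a)Γ(c−b))` as `x → 1⁻` (`x` real). [cite: DLMF, 15.4.20] -/
theorem tendsto_eulerHypergeometric_ofReal_one (a : ℂ) {b c : ℂ} (hb : 0 < b.re)
    (hbc : b.re < c.re) (h : 0 < (c - a - b).re) :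
    Tendsto (fun x : ℝ => eulerHypergeometric a b c x) (𝓝[<] 1)
      (𝓝 (Complex.Gamma c * Complex.Gamma (c - a - b) /
        (Complex.Gamma (c - a) * Complex.Gamma (c - b)))) := by
  have hmap : Tendsto (fun x : ℝ => (x : ℂ)) (𝓝[<] 1) (𝓝[{z : ℂ | z.re < 1}] 1) := by
    have h1 := (Complex.continuous_ofReal.continuousWithinAt (s := Iio (1 : ℝ))
      (x := 1)).tendsto_nhdsWithin (t := {z : ℂ | z.re < 1}) fun x hx => by
        simpa using hx
    simpa using h1
  exact (tendsto_eulerHypergeometric_one a hb hbc h).comp hmap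

/-- **Gauss's theorem for Mathlib's series along the reals (Abel-type form)**: for
`Re c > Re b > 0` and `Re(c − a − b) > 0`, `₂F₁(a,b;c;x) → Γ(c)Γ(c−a−b)/(Γ(c−a)Γ(c−b))` as
`x → 1⁻` — on `(−1,1)` the series equals Euler's integral (DLMF 15.6.1). (The convergence of the
series AT `x = 1` is not asserted.) [cite: DLMF, 15.4.20] -/
theorem tendsto_ordinaryHypergeometric_one (a : ℂ) {b c : ℂ} (hb : 0 < b.re) (hbc : b.re < c.re)
    (h : 0 < (c - a - b).re) :
    Tendsto (fun x : ℝ => ₂F₁ a b c (x : ℂ)) (𝓝[<] 1)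
      (𝓝 (Complex.Gamma c * Complex.Gamma (c - a - b) /
        (Complex.Gamma (c - a) * Complex.Gamma (c - b)))) := by
  refine (tendsto_eulerHypergeometric_ofReal_one a hb hbc h).congr' ?_
  filter_upwards [Ioo_mem_nhdsLT (show (-1 : ℝ) < 1 by norm_num)] with x hx
  exact eulerHypergeometric_eq_ordinaryHypergeometric a hb hbc
    (by rw [Complex.norm_real, Real.norm_eq_abs, abs_lt]; exact ⟨hx.1, hx.2⟩)

end Literature.Analysis.SpecialFunctions.Hypergeometric

end
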